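import Mathlib
import Literature.Analysis.FluidPDE.VorticityCalculus
import Literature.Analysis.FluidPDE.VorticityStretching
import Literature.Analysis.FluidPDE.LocalHelmholtzSupBound
import Literature.Analysis.FluidPDE.NewtonKernel
import Summits.NavierStokesRegularity.NavierStokesRegularity.Theorems.ThreadingFluxCentreJetDriftLaw
import Summits.NavierStokesRegularity.NavierStokesRegularity.Theorems.ThreadingFluxCentreJetLocalCentreLaws
import HarnessLib

/-!
# Crux `PoloidalLiouville` (stmt-NavierStokesRegularity-1222, wall W1), crux idea «steady-centre-sieve» (ns-idea-15 g5):
# the centre drift law E2 on a BALL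

Support file (Theorems-side; seat ns-wall-eng-7 g5, cell ns-wall-extremal, W1 adjunct; `--supports stmt-NavierStokesRegularity-1222
--as helper`).  Local form of the landed law E2 `CentreJet.centreDriftLaw` (p680023, which asks for a classical steady flow on all of `ℝ³`
unthreaded on all of `ℝ³`): for a classical steady Navier–Stokes flow on a BALL `B(x₀, ρ)` (`IsSteadyNSOn (ball x₀ ρ) V p`) unthreaded on
the ball, `V(x₀) × ΔV(x₀) = 0` — the setting of the card's conjectures C1/C1* (type N: `ΔV(x₀) ≠ 0` spans the axis).

Proof: the jet facts at the centre come from E1 on a ball (`centreVorticityJet_of_ball`, p689050); the pointwise identities of the global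
proof (`curl ∇ = 0`, `curl Δ = Δ curl`, `curl ((V·∇)V)`, `curl curl = ∇div − Δ`) are applied to smooth CUT-OFF copies `χV`, `χp`
(`χ` a bump equal to `1` near `x₀`, supported in the ball) and transported back through the germ at `x₀`.

* `CentreJet.centreDriftLaw_of_ball`.

HONEST LABEL: vector-calculus localisation of an S-lemma; conjectures and target of the card, `PoloidalLiouville` (1222) and NS regularity
OPEN and untouched; information-grade.  [cite: MajdaBertozziCUP2002, §1.1 (vector identities)]
-/

-- the summit and its single problem share the name (D-0017 nested layout)
set_option linter.dupNamespace false

noncomputable section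

open Set Function Filter
open scoped RealInnerProductSpace Topology
open Literature.Analysis.FluidPDE

namespace Summit.NavierStokesRegularity.NavierStokesRegularity.Theorems.PoloidalLiouville.CentreJet

section LocalDrift

/-- A function which is `C^n` on a ball agrees, on a neighbourhood of the centre, with a GLOBAL `C^n` function (bump cut-off). -/
theorem exists_contDiff_eventuallyEq_of_ball {F : Type*} [NormedAddCommGroup F] [NormedSpace ℝ F] {n : ℕ∞} {f : E3 → F}
    {x₀ : E3} {ρ : ℝ} (hρ : 0 < ρ) (hf : ContDiffOn ℝ n f (Metric.ball x₀ ρ)) :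
    ∃ g : E3 → F, ContDiff ℝ n g ∧ g =ᶠ[𝓝 x₀] f := by
  let χ : ContDiffBump x₀ := ⟨ρ / 4, ρ / 2, by positivity, by linarith⟩
  refine ⟨fun y => χ y • f y, ?_, ?_⟩
  · rw [contDiff_iff_contDiffAt]
    intro y
    by_cases hy : y ∈ Metric.ball x₀ ρ
    · exact (χ.contDiff (n := n)).contDiffAt.smul (hf.contDiffAt (Metric.isOpen_ball.mem_nhds hy))
    · have hy' : y ∉ tsupport (χ : E3 → ℝ) := by
        rw [χ.tsupport_eq]
        intro h
        apply hy
        have h' : dist y x₀ ≤ ρ / 2 := Metric.mem_closedBall.1 h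
        exact Metric.mem_ball.2 (by linarith)
      have h0 : (fun y => χ y • f y) =ᶠ[𝓝 y] fun _ => (0 : F) := by
        filter_upwards [notMem_tsupport_iff_eventuallyEq.1 hy'] with z hz
        simp [hz]
      exact contDiffAt_const.congr_of_eventuallyEq h0
  · filter_upwards [Metric.ball_mem_nhds x₀ (by positivity : (0 : ℝ) < ρ / 4)] with y hy
    rw [χ.one_of_mem_closedBall (Metric.ball_subset_closedBall hy), one_smul]

/-- An eventual equality at `x₀` holds eventually as an eventual equality (germs agree on an open neighbourhood). -/
theorem eventually_eventuallyEq_of_eventuallyEq {F : Type*} {f g : E3 → F} {x₀ : E3} (h : f =ᶠ[𝓝 x₀] g) :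
    ∀ᶠ z in 𝓝 x₀, f =ᶠ[𝓝 z] g := by
  obtain ⟨N, hN, hNo, hx₀N⟩ := mem_nhds_iff.1 h
  filter_upwards [hNo.mem_nhds hx₀N] with z hz
  exact Filter.eventuallyEq_of_mem (hNo.mem_nhds hz) fun w hw => hN hw

/-- ★ **(E2 on a ball) `CentreJet.centreDriftLaw_of_ball`.**  For a classical steady Navier–Stokes flow on the ball `B(x₀, ρ)` unthreaded on
the ball, `V(x₀) × ΔV(x₀) = 0`. -/
theorem centreDriftLaw_of_ball (V : E3 → E3) (p : E3 → ℝ) (x₀ : E3) {ρ : ℝ} (hρ : 0 < ρ)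
    (hNS : IsSteadyNSOn (Metric.ball x₀ ρ) V p) (hun : ∀ x ∈ Metric.ball x₀ ρ, inner ℝ (x - x₀) (curl V x) = 0) :
    cross (V x₀) (Laplacian.laplacian V x₀) = 0 := by
  obtain ⟨hV, hp, hdiv, heq⟩ := hNS
  have hball : Metric.ball x₀ ρ ∈ 𝓝 x₀ := Metric.ball_mem_nhds x₀ hρ
  have hopen : IsOpen (Metric.ball x₀ ρ) := Metric.isOpen_ball
  -- the jet at the centre (E1 on a ball)
  obtain ⟨hω0, hskew, hΔω⟩ := centreVorticityJet_of_ball V x₀ hρ hV hun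
  -- `p ∈ C²` on the ball: `∇p = ΔV − (V·∇)V ∈ C¹`
  have hDV2 : ContDiffOn ℝ 2 (fderiv ℝ V) (Metric.ball x₀ ρ) := hV.fderiv_of_isOpen hopen (by norm_num)
  have hconv1 : ContDiffOn ℝ 1 (fun x => fderiv ℝ V x (V x)) (Metric.ball x₀ ρ) :=
    (hDV2.of_le (by norm_num)).clm_apply (hV.of_le (by norm_num))
  obtain ⟨V₃, hV₃, hV₃eq⟩ := exists_contDiff_eventuallyEq_of_ball hρ hV
  have hV₃2 : ContDiff ℝ 2 V₃ := hV₃.of_le (by norm_num)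
  -- `ΔV` is `C¹` on the ball (through the global copy near each point: use the explicit orthonormal-sum formula)
  have hΔ1 : ContDiffOn ℝ 1 (Laplacian.laplacian V) (Metric.ball x₀ ρ) := by
    intro y hy
    -- localise at `y` with a bump around `y` inside the ball
    obtain ⟨ε, hε, hεball⟩ := Metric.mem_nhds_iff.1 (hopen.mem_nhds hy)
    obtain ⟨W', hW', hW'eq⟩ := exists_contDiff_eventuallyEq_of_ball hε (hV.mono hεball)
    have hΔeq : Laplacian.laplacian V =ᶠ[𝓝 y] Laplacian.laplacian W' := by
      filter_upwards [eventually_eventuallyEq_of_eventuallyEq hW'eq] with z hz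
      exact (laplacian_congr_of_eventuallyEq hz).symm
    have hΔW' : ContDiff ℝ 1 (Laplacian.laplacian W') := contDiff_laplacian (n := 1) (by exact_mod_cast hW')
    exact (hΔW'.contDiffAt.congr_of_eventuallyEq hΔeq).contDiffWithinAt
  have hgrad : ∀ x ∈ Metric.ball x₀ ρ, gradient p x = Laplacian.laplacian V x - fderiv ℝ V x (V x) := fun x hx => by
    rw [← heq x hx]; abel
  have hgp1 : ContDiffOn ℝ 1 (gradient p) (Metric.ball x₀ ρ) := (hΔ1.sub hconv1).congr hgrad
  have hp2 : ContDiffOn ℝ 2 p (Metric.ball x₀ ρ) := by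
    rw [show (2 : WithTop ℕ∞) = 1 + 1 by norm_num, contDiffOn_succ_iff_fderiv_of_isOpen hopen]
    refine ⟨hp.differentiableOn one_ne_zero, by simp, ?_⟩
    have hfd : ∀ x ∈ Metric.ball x₀ ρ, fderiv ℝ p x = (InnerProductSpace.toDual ℝ E3) (gradient p x) := fun x _ => by
      simp [gradient]
    exact ((InnerProductSpace.toDual ℝ E3).contDiff.comp_contDiffOn hgp1).congr hfd
  obtain ⟨p₂, hp₂, hp₂eq⟩ := exists_contDiff_eventuallyEq_of_ball hρ hp2
  -- germ transfers at `x₀`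
  have hVeq' := eventually_eventuallyEq_of_eventuallyEq hV₃eq      -- `V₃ = V` near every point near `x₀`
  have hpeq' := eventually_eventuallyEq_of_eventuallyEq hp₂eq
  have hcurlV : curl V₃ =ᶠ[𝓝 x₀] curl V := by
    filter_upwards [hVeq'] with z hz
    rw [curl_eq_curlCLM, curl_eq_curlCLM, hz.fderiv_eq]
  have hΔV : Laplacian.laplacian V₃ =ᶠ[𝓝 x₀] Laplacian.laplacian V := by
    filter_upwards [hVeq'] with z hz
    exact laplacian_congr_of_eventuallyEq hz
  have hconvV : (fun x => fderiv ℝ V₃ x (V₃ x)) =ᶠ[𝓝 x₀] fun x => fderiv ℝ V x (V x) := by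
    filter_upwards [hVeq', hV₃eq] with z hz hz'
    rw [hz.fderiv_eq, hz']
  have hgradp : gradient p₂ =ᶠ[𝓝 x₀] gradient p := by
    filter_upwards [hpeq'] with z hz
    simp only [gradient, hz.fderiv_eq]
  have hdivV : ∀ᶠ z in 𝓝 x₀, VectorCalculus.divergence V₃ z = 0 := by
    filter_upwards [hVeq', hball] with z hz hzb
    rw [VectorCalculus.divergence, hz.fderiv_eq]
    exact hdiv z hzb
  -- the momentum equation near `x₀`, in terms of the global copies: `∇p₂ = ΔV₃ − (V₃·∇)V₃`
  have hmom : gradient p₂ =ᶠ[𝓝 x₀] fun x => Laplacian.laplacian V₃ x - fderiv ℝ V₃ x (V₃ x) := by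
    filter_upwards [hgradp, eventually_eventuallyEq_of_eventuallyEq hΔV, eventually_eventuallyEq_of_eventuallyEq hconvV, hball]
      with z hz hΔz hcz hzb
    rw [hz, hgrad z hzb, hΔz.symm.eq_of_nhds, hcz.symm.eq_of_nhds]
  -- curl of both sides at `x₀`
  have hcurl0 : curl (gradient p₂) x₀ = 0 := curl_gradient_eq_zero_holds p₂ hp₂ x₀
  have hω0' : curl V₃ x₀ = 0 := by rw [hcurlV.eq_of_nhds]; exact hω0
  have hcurlΔ : curl (Laplacian.laplacian V₃) x₀ = 0 := by
    rw [curl_laplacian hV₃ x₀, laplacian_congr_of_eventuallyEq hcurlV]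
    exact hΔω
  have hcurlconv : curl (fun x => fderiv ℝ V₃ x (V₃ x)) x₀ = fderiv ℝ (curl V) x₀ (V x₀) := by
    have h := curl_convect_self hV₃2 x₀
    simp only [convect_apply, hω0', map_zero, smul_zero, sub_zero, add_zero] at h
    rw [hcurlV.fderiv_eq, hV₃eq.eq_of_nhds] at h
    exact h
  have hΔd : DifferentiableAt ℝ (Laplacian.laplacian V₃) x₀ :=
    ((contDiff_laplacian (n := 1) (by exact_mod_cast hV₃)).differentiable (by simp)) x₀
  have hconv1' : ContDiff ℝ 1 (fun x => fderiv ℝ V₃ x (V₃ x)) :=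
    (hV₃.fderiv_right (m := 1) (by norm_num)).clm_apply (hV₃.of_le (by norm_num))
  have hcd : DifferentiableAt ℝ (fun x => fderiv ℝ V₃ x (V₃ x)) x₀ := (hconv1'.differentiable (by simp)) x₀
  have hAv : fderiv ℝ (curl V) x₀ (V x₀) = 0 := by
    have h := hcurl0
    rw [curl_eq_curlCLM, hmom.fderiv_eq, ← curl_eq_curlCLM, curl_sub hΔd hcd, hcurlΔ, hcurlconv, zero_sub, neg_eq_zero] at h
    exact h
  -- `curl curl V (x₀) = −ΔV(x₀)` (the divergence vanishes near `x₀`)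
  have hcc : curl (curl V) x₀ = -Laplacian.laplacian V x₀ := by
    have h := curl_curl_eq_sum_fderiv_divergence_sub_laplacian hV₃2 x₀
    have hD : fderiv ℝ (VectorCalculus.divergence V₃) x₀ = 0 := by
      rw [(Filter.EventuallyEq.fderiv_eq (hdivV.mono fun z hz => hz : VectorCalculus.divergence V₃ =ᶠ[𝓝 x₀] fun _ => 0)),
        fderiv_const_apply]
    simp only [hD, _root_.zero_apply, zero_smul, Finset.sum_const_zero, zero_sub] at h
    rw [hΔV.eq_of_nhds] at h
    -- `h : curl (curl V₃) x₀ = -ΔV x₀`; transport the outer curl through the germ of `curl V₃ = curl V`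
    rw [curl_eq_curlCLM, ← hcurlV.fderiv_eq, ← curl_eq_curlCLM]
    exact h
  -- `∇ω(x₀)` is skew: `∇ω(x₀) y = ½ (curl ω)(x₀) × y`
  have hrepr := apply_eq_half_cross_curlCLM_of_skew (fderiv ℝ (curl V) x₀) hskew (V x₀)
  rw [hAv, ← curl_eq_curlCLM, hcc] at hrepr
  have h2 : cross (-(Laplacian.laplacian V x₀)) (V x₀) = 0 := by
    have h := hrepr.symm
    rwa [smul_eq_zero, or_iff_right (by norm_num : ¬ (1 / 2 : ℝ) = 0)] at h
  have h3 : cross (-(Laplacian.laplacian V x₀)) (V x₀) = cross (V x₀) (Laplacian.laplacian V x₀) := by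
    ext i
    fin_cases i <;> (simp [cross, cross_apply]; try ring)
  rw [h3] at h2
  exact h2

end LocalDrift

end Summit.NavierStokesRegularity.NavierStokesRegularity.Theorems.PoloidalLiouville.CentreJet

end
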